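import Literature.FieldTheory.AlgClosed.PuiseuxAtInfinityFormal
import HarnessLib

/-!
# Puiseux expansions at infinity: the formal normal form (main statement)

Sequel of `PuiseuxAtInfinityFormal.lean`; see there for the mathematics. Main result:
`PuiseuxInfinity.exists_formal_normal_form_at_infinity` — for `k` algebraically closed of
characteristic `0` and `Q ∈ k[u][Y]` irreducible of `Y`-degree `d ≥ 1` there are `e ≥ 1`, `M`,
`Q' ∈ k[t][Y]` of `Y`-degree `≤ d` with top coefficient `c`, `c(0) ≠ 0`, and pairwise distinct
`r₁, …, r_d ∈ k⟦t⟧` with `Q'(t, Y) = c(t) ∏ᵢ (Y - rᵢ(t))` coefficientwise in `k⟦t⟧[Y]` and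
`Q'(t, t^M v) = 0 ↔ Q(t^{-e}, v) = 0` for `t ∈ kˣ`, `v ∈ k`. [folklore]

## References

* J.-P. Serre, *Local Fields*, GTM 67, Ch. IV §2, Prop. 8.
* E. Brieskorn, H. Knörrer, *Plane Algebraic Curves*, Birkhäuser 1986, §8.3. [folklore]
-/

noncomputable section

open Polynomial HahnSeries LaurentSeries
open Literature.Barriers.ResolutionOfSingularities (ramify ramify_single)

namespace Literature.FieldTheory.AlgClosed

namespace PuiseuxInfinity

/-- A non-zero polynomial of degree `≤ d` with `d` distinct roots `yᵢ` over a domain is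
`lead · ∏ᵢ (X - yᵢ)`. [folklore] -/
theorem eq_C_mul_prod_of_roots {R : Type*} [CommRing R] [IsDomain R] {p : R[X]} (hp : p ≠ 0)
    {d : ℕ} (hdeg : p.natDegree ≤ d) {y : Fin d → R} (hy : Function.Injective y)
    (hroots : ∀ i, p.eval (y i) = 0) :
    p = Polynomial.C p.leadingCoeff * ∏ i, (Polynomial.X - Polynomial.C (y i)) := by
  classical
  set S : Finset R := Finset.univ.map ⟨y, hy⟩ with hS
  have hScard : S.card = d := by simp [hS]
  have hsub : S.val ≤ p.roots := by
    rw [Finset.val_le_iff_val_subset]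
    intro a ha
    rw [Finset.mem_val, hS, Finset.mem_map] at ha
    obtain ⟨i, -, rfl⟩ := ha
    exact (mem_roots hp).2 (hroots i)
  have hle : Multiset.card p.roots ≤ Multiset.card S.val := by
    rw [Finset.card_val, hScard]; exact (card_roots' p).trans hdeg
  have heq : p.roots = S.val := (Multiset.eq_of_le_of_card_le hsub hle).symm
  have hcard : Multiset.card p.roots = p.natDegree := by
    apply le_antisymm (card_roots' p)
    rw [heq, Finset.card_val, hScard]; exact hdeg
  conv_lhs => rw [← C_leadingCoeff_mul_prod_multiset_X_sub_C hcard]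
  congr 1
  rw [heq, ← Finset.prod_eq_multiset_prod, hS, Finset.prod_map]
  rfl

variable {k : Type} [Field k] [IsAlgClosed k] [CharZero k]

/-- **Formal normal form of a plane curve at infinity.** For `Q ∈ k[u][Y]` irreducible of
`Y`-degree `d ≥ 1` (`k` algebraically closed, `char k = 0`) there are a ramification index
`e ≥ 1`, an exponent `M`, a polynomial `Q' ∈ k[t][Y]` with `deg_Y Q' ≤ d` and top coefficient
`c = [Y^d] Q'` with `c(0) ≠ 0`, and `d` pairwise distinct power series `rᵢ ∈ k⟦t⟧` such that
`Q'(t, Y) = c(t) · ∏ᵢ (Y - rᵢ(t))` coefficientwise in `k⟦t⟧`, and, for `t ≠ 0`,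
`Q'(t, t^M v) = 0 ↔ Q(t^{-e}, v) = 0`. (The `rᵢ(t) t^{-M}`, `t = u^{-1/e}`, are the Puiseux
expansions at `u = ∞` of the roots of `Q(u, ·)`.) [folklore] -/
theorem exists_formal_normal_form_at_infinity (Q : Polynomial k[X]) (hirr : Irreducible Q)
    (hd : 0 < Q.natDegree) :
    ∃ (e : ℕ) (_ : 0 < e) (M : ℕ) (Q' : Polynomial k[X]) (c : k[X])
      (r : Fin Q.natDegree → PowerSeries k),
      Q'.natDegree ≤ Q.natDegree ∧ Q'.coeff Q.natDegree = c ∧ c.eval 0 ≠ 0 ∧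
      Function.Injective r ∧
      (∀ n, ((Q'.coeff n : k[X]) : PowerSeries k) =
        (Polynomial.C (c : PowerSeries k) *
          ∏ i, (Polynomial.X - Polynomial.C (r i))).coeff n) ∧
      ∀ t : k, t ≠ 0 → ∀ v : k,
        ((Q'.map (evalRingHom t)).eval (t ^ M * v) = 0 ↔
          (Q.map (evalRingHom (t ^ e)⁻¹)).eval v = 0) := by
  classical
  -- ### notation and the splitting over `k⸨t⸩`
  have hQ0 : Q ≠ 0 := by rintro rfl; simp at hd
  set d : ℕ := Q.natDegree with hd_def
  set φ : k[X] →+* k⸨X⸩ := eval₂RingHom (HahnSeries.C : k →+* k⸨X⸩) (single (-1 : ℤ) 1) with hφ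
  have hφinj : Function.Injective φ := fun p q h => eval₂_atInfty_injective h
  set F : Polynomial k⸨X⸩ := Q.map φ with hF
  obtain ⟨e, he, hsplit⟩ := NewtonPuiseux_holds k F
  set G : Polynomial k⸨X⸩ := F.map (ramify k e he) with hG
  have hGsep : G.Separable := by
    rw [hG, hF]; exact (separable_map_atInfty hirr hd).map
  have hFdeg : F.natDegree = d := by rw [hF, natDegree_map_eq_of_injective hφinj]
  have hGdeg : G.natDegree = d := by
    rw [hG, natDegree_map_eq_of_injective (ramify k e he).injective, hFdeg]
  have hGcoeff : ∀ n, G.coeff n = ramify k e he (φ (Q.coeff n)) := fun n => by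
    rw [hG, coeff_map, hF, coeff_map]
  have hG0 : G ≠ 0 := by
    intro h; rw [h, natDegree_zero] at hGdeg; omega
  have hcard : Multiset.card G.roots = d := by rw [← hsplit.natDegree_eq_card_roots, hGdeg]
  have hnodup : G.roots.Nodup := nodup_roots hGsep
  set S : Finset k⸨X⸩ := G.roots.toFinset with hS
  have hScard : S.card = d := by rw [hS, Multiset.toFinset_card_of_nodup hnodup, hcard]
  let ε : S ≃ Fin d := Finset.equivFinOfCardEq hScard
  let ρ : Fin d → k⸨X⸩ := fun i => ((ε.symm i : S) : k⸨X⸩)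
  have hρinj : Function.Injective ρ := fun i j h => ε.symm.injective (Subtype.ext h)
  have hρroot : ∀ i, G.eval (ρ i) = 0 := fun i => by
    have hmem : ρ i ∈ G.roots := Multiset.mem_toFinset.1 (ε.symm i).2
    exact (mem_roots hG0).1 hmem
  -- ### exponents
  set D : ℕ := (Finset.range (d + 1)).sup fun n => (Q.coeff n).natDegree with hD
  have hDn : ∀ n, (Q.coeff n).natDegree ≤ D := by
    intro n
    by_cases hn : n ≤ d
    · exact Finset.le_sup (f := fun n => (Q.coeff n).natDegree)
        (Finset.mem_range.2 (Nat.lt_succ_of_le hn))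
    · rw [coeff_eq_zero_of_natDegree_lt (not_le.1 hn), natDegree_zero]; exact Nat.zero_le _
  set dd : ℕ := (Q.coeff d).natDegree with hdd
  set κ : ℕ := e * (D - dd) with hκ
  set M₀ : ℕ := Finset.univ.sup fun i : Fin d => (-(ρ i).order).toNat with hM₀
  set M : ℕ := M₀ + κ with hM
  have hκM : κ ≤ M := Nat.le_add_left _ _
  have hM₀M : ∀ i, (-(ρ i).order).toNat ≤ M := fun i =>
    (Finset.le_sup (f := fun i : Fin d => (-(ρ i).order).toNat) (Finset.mem_univ i)).trans
      (Nat.le_add_right _ _)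
  -- ### the polynomials `p n`, `c`, `Q'`
  set p : ℕ → k[X] := fun n =>
    ∑ j ∈ Finset.range (D + 1), Polynomial.C ((Q.coeff n).coeff j) * X ^ (e * (D - j)) with hp
  set c : k[X] :=
    ∑ j ∈ Finset.range (dd + 1), Polynomial.C ((Q.coeff d).coeff j) * X ^ (e * (dd - j)) with hc
  have hpd : p d = X ^ κ * c := by
    simp only [hp, hc, hκ, hdd]
    exact revExpand_eq_X_pow_mul (Q.coeff d) e D (hDn d)
  have hc0 : c.eval 0 ≠ 0 := by
    rw [hc, eval_zero_revExpand_natDegree (Q.coeff d) he]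
    exact Polynomial.leadingCoeff_ne_zero.2 (Polynomial.leadingCoeff_ne_zero.2 hQ0)
  set Q' : Polynomial k[X] :=
    ∑ n ∈ Finset.range d, Polynomial.C (X ^ (M * (d - n) - κ) * p n) * X ^ n +
      Polynomial.C c * X ^ d with hQ'
  have hQ'coeff : ∀ n, Q'.coeff n =
      (if n < d then X ^ (M * (d - n) - κ) * p n else 0) + if n = d then c else 0 := by
    intro n
    rw [hQ', Polynomial.coeff_add, finsetSum_coeff, Polynomial.coeff_C_mul_X_pow]
    congr 1
    · simp only [Polynomial.coeff_C_mul_X_pow]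
      split_ifs with hn
      · rw [Finset.sum_eq_single n]
        · rw [if_pos rfl]
        · intro b _ hb; rw [if_neg (Ne.symm hb)]
        · intro h; exact absurd (Finset.mem_range.2 hn) h
      · exact Finset.sum_eq_zero fun b hb => if_neg (by
          rintro rfl; exact hn (Finset.mem_range.1 hb))
  have hQ'lt : ∀ n, n < d → Q'.coeff n = X ^ (M * (d - n) - κ) * p n := fun n hn => by
    rw [hQ'coeff, if_pos hn, if_neg hn.ne, add_zero]
  have hQ'd : Q'.coeff d = c := by
    rw [hQ'coeff, if_neg (lt_irrefl d), if_pos rfl, zero_add]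
  have hQ'gt : ∀ n, d < n → Q'.coeff n = 0 := fun n hn => by
    rw [hQ'coeff, if_neg (not_lt.2 hn.le), if_neg hn.ne', add_zero]
  have hQ'deg : Q'.natDegree ≤ d := by
    rw [natDegree_le_iff_coeff_eq_zero]
    intro n hn
    exact hQ'gt n (by exact_mod_cast hn)
  have hc_ne : c ≠ 0 := by rintro h; rw [h, eval_zero] at hc0; exact hc0 rfl
  have hQ'0 : Q' ≠ 0 := by
    intro h
    have := hQ'd
    rw [h, Polynomial.coeff_zero] at this
    exact hc_ne this.symm
  have hQ'natDegree : Q'.natDegree = d :=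
    le_antisymm hQ'deg (le_natDegree_of_ne_zero (by rw [hQ'd]; exact hc_ne))
  have hQ'lead : Q'.leadingCoeff = c := by rw [Polynomial.leadingCoeff, hQ'natDegree, hQ'd]
  -- ### the Laurent images
  set ψ : k[X] →+* k⸨X⸩ :=
    (ofPowerSeries ℤ k).comp (Polynomial.coeToPowerSeries.ringHom : k[X] →+* PowerSeries k)
    with hψ
  have hψapp : ∀ q : k[X], ψ q = ofPowerSeries ℤ k (q : PowerSeries k) := fun q => rfl
  have hψinj : Function.Injective ψ := fun p q h =>
    Polynomial.coe_injective k (ofPowerSeries_injective h)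
  have hψX : ∀ m : ℕ, ψ (X ^ m) = single (m : ℤ) 1 := fun m => by
    rw [hψapp, Polynomial.coe_pow, Polynomial.coe_X, map_pow, ofPowerSeries_X, single_pow]; simp
  have hψp : ∀ n, ψ (p n) = single ((e * D : ℕ) : ℤ) 1 * G.coeff n := fun n => by
    rw [hGcoeff, hψapp, hp]
    exact (single_mul_ramify_eval₂_atInfty (Q.coeff n) e he D (hDn n)).symm
  set T : ℤ := (M * d : ℕ) - κ + (e * D : ℕ) with hT
  set Q'L : Polynomial k⸨X⸩ := Q'.map ψ with hQ'L
  -- coefficient formula: `[Yⁿ] Q'L = t^{M(d-n) - κ + eD} · [Yⁿ] G`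
  have hQ'Lcoeff : ∀ n, n ≤ d →
      Q'L.coeff n = single ((M * (d - n) : ℕ) - (κ : ℤ) + (e * D : ℕ)) 1 * G.coeff n := by
    intro n hn
    rw [hQ'L, coeff_map]
    rcases hn.lt_or_eq with hlt | rfl
    · rw [hQ'lt n hlt, map_mul, hψX, hψp, ← mul_assoc, single_mul_single, one_mul]
      congr 2
      have : κ ≤ M * (d - n) := hκM.trans (Nat.le_mul_of_pos_right M (Nat.sub_pos_of_lt hlt))
      push_cast [Nat.cast_sub this]
      ring
    · rw [hQ'd]
      have h1 : ψ (p d) = single (κ : ℤ) 1 * ψ c := by rw [hpd, map_mul, hψX]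
      have h2 : ψ c = single (-(κ : ℤ)) 1 * ψ (p d) := by
        rw [h1, ← mul_assoc, single_mul_single, neg_add_cancel, one_mul]
        simp
      rw [h2, hψp, ← mul_assoc, single_mul_single, one_mul]
      congr 2
      simp
  -- the roots `t^M ρᵢ`
  have hQ'Ldeg : Q'L.natDegree ≤ d := (natDegree_map_le).trans hQ'deg
  have hQ'L0 : Q'L ≠ 0 := by
    rw [hQ'L]; exact (Polynomial.map_ne_zero_iff hψinj).2 hQ'0
  have hrootL : ∀ i, Q'L.eval (single (M : ℤ) 1 * ρ i) = 0 := by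
    intro i
    rw [eval_eq_sum_range' (Nat.lt_succ_of_le hQ'Ldeg)]
    have hGsum : G.eval (ρ i) = ∑ n ∈ Finset.range (d + 1), G.coeff n * ρ i ^ n :=
      eval_eq_sum_range' (by rw [hGdeg]; exact Nat.lt_succ_self d) _
    calc ∑ n ∈ Finset.range (d + 1), Q'L.coeff n * (single (M : ℤ) 1 * ρ i) ^ n
        = ∑ n ∈ Finset.range (d + 1), single T 1 * (G.coeff n * ρ i ^ n) := by
          refine Finset.sum_congr rfl fun n hn => ?_
          have hnd : n ≤ d := Nat.lt_succ_iff.1 (Finset.mem_range.1 hn)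
          rw [hQ'Lcoeff n hnd, mul_pow, single_pow, one_pow, mul_mul_mul_comm, single_mul_single,
            one_mul]
          congr 2
          rw [hT]
          simp only [nsmul_eq_mul]
          push_cast [Nat.cast_sub hnd]
          ring
      _ = single T 1 * G.eval (ρ i) := by rw [hGsum, Finset.mul_sum]
      _ = 0 := by rw [hρroot, mul_zero]
  have hsM0 : (single (M : ℤ) (1 : k) : k⸨X⸩) ≠ 0 := by simp
  have hrLinj : Function.Injective fun i => single (M : ℤ) (1 : k) * ρ i :=
    fun i j h => hρinj (mul_left_cancel₀ hsM0 h)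
  have hfactL : Q'L = Polynomial.C (ψ c) *
      ∏ i, (Polynomial.X - Polynomial.C (single (M : ℤ) (1 : k) * ρ i)) := by
    have h := eq_C_mul_prod_of_roots hQ'L0 hQ'Ldeg hrLinj hrootL
    rwa [show Q'L.leadingCoeff = ψ c by
      rw [hQ'L, leadingCoeff_map_of_injective hψinj, hQ'lead]] at h
  -- ### power series roots
  have horder : ∀ i, 0 ≤ (single (M : ℤ) (1 : k) * ρ i).orderTop := by
    intro i
    by_cases hρ0 : ρ i = 0
    · simp [hρ0]
    rw [orderTop_mul, orderTop_single one_ne_zero, ← order_eq_orderTop_of_ne_zero hρ0,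
      ← WithTop.coe_add, WithTop.coe_nonneg]
    have := hM₀M i
    omega
  set r : Fin d → PowerSeries k := fun i =>
    PowerSeries.mk fun m : ℕ => (single (M : ℤ) (1 : k) * ρ i).coeff m with hr
  have hrcoe : ∀ i, ofPowerSeries ℤ k (r i) = single (M : ℤ) (1 : k) * ρ i := fun i =>
    ofPowerSeries_mk_coeff (horder i)
  have hrinj : Function.Injective r := by
    intro i j h
    have := congrArg (ofPowerSeries ℤ k) h
    rw [hrcoe, hrcoe] at this
    exact hrLinj this
  -- ### descend the factorisation to `k⟦t⟧`
  have hfactP : Q'.map (Polynomial.coeToPowerSeries.ringHom : k[X] →+* PowerSeries k) =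
      Polynomial.C (c : PowerSeries k) * ∏ i, (Polynomial.X - Polynomial.C (r i)) := by
    apply Polynomial.map_injective (ofPowerSeries ℤ k) ofPowerSeries_injective
    rw [Polynomial.map_map, ← hψ, ← hQ'L, hfactL, Polynomial.map_mul, Polynomial.map_C,
      Polynomial.map_prod]
    congr 1
    refine Finset.prod_congr rfl fun i _ => ?_
    rw [Polynomial.map_sub, Polynomial.map_X, Polynomial.map_C, hrcoe]
  -- ### conclusion
  refine ⟨e, he, M, Q', c, r, hQ'deg, hQ'd, hc0, hrinj, fun n => ?_, fun t ht v => ?_⟩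
  · have := congrArg (fun P : Polynomial (PowerSeries k) => P.coeff n) hfactP
    simpa only [coeff_map, Polynomial.coeToPowerSeries.ringHom_apply] using this
  · -- evaluation identity: `t^κ · Q'(t, t^M v) = t^{Md + eD} · Q(t^{-e}, v)`
    have hpeval : ∀ n, (p n).eval t = t ^ (e * D) * (Q.coeff n).eval (t ^ e)⁻¹ := fun n =>
      eval_revExpand (Q.coeff n) e D t ht (hDn n)
    have key : t ^ κ * (Q'.map (evalRingHom t)).eval (t ^ M * v) =
        t ^ (M * d + e * D) * (Q.map (evalRingHom (t ^ e)⁻¹)).eval v := by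
      rw [eval_map, eval₂_eq_sum_range' _ (Nat.lt_succ_of_le hQ'deg), eval_map,
        eval₂_eq_sum_range' _ (Nat.lt_succ_self _), Finset.mul_sum, Finset.mul_sum]
      refine Finset.sum_congr rfl fun n hn => ?_
      have hnd : n ≤ d := Nat.lt_succ_iff.1 (Finset.mem_range.1 hn)
      simp only [coe_evalRingHom]
      rcases hnd.lt_or_eq with hlt | rfl
      · have hle : κ ≤ M * (d - n) :=
          hκM.trans (Nat.le_mul_of_pos_right M (Nat.sub_pos_of_lt hlt))
        rw [hQ'lt n hlt, eval_mul, eval_pow, eval_X, hpeval, mul_pow, ← pow_mul]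
        have : t ^ κ * (t ^ (M * (d - n) - κ) * (t ^ (e * D) * (Q.coeff n).eval (t ^ e)⁻¹) *
            (t ^ (M * n) * v ^ n)) =
            t ^ (κ + (M * (d - n) - κ) + e * D + M * n) * ((Q.coeff n).eval (t ^ e)⁻¹ * v ^ n) := by
          ring
        rw [this]
        congr 2
        calc κ + (M * (d - n) - κ) + e * D + M * n
            = M * (d - n) + M * n + e * D := by rw [Nat.add_sub_cancel' hle]; ring
          _ = M * d + e * D := by rw [← Nat.mul_add, Nat.sub_add_cancel hnd]
      · rw [hQ'd, mul_pow, ← pow_mul]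
        have h1 : t ^ κ * c.eval t = t ^ (e * D) * (Q.coeff d).eval (t ^ e)⁻¹ := by
          rw [← hpeval d, hpd, eval_mul, eval_pow, eval_X]
        calc t ^ κ * (c.eval t * (t ^ (M * d) * v ^ d))
            = (t ^ κ * c.eval t) * (t ^ (M * d) * v ^ d) := by ring
          _ = t ^ (M * d + e * D) * ((Q.coeff d).eval (t ^ e)⁻¹ * v ^ d) := by
            rw [h1, pow_add]; ring
    have htκ : t ^ κ ≠ 0 := pow_ne_zero _ ht
    have htT : t ^ (M * d + e * D) ≠ 0 := pow_ne_zero _ ht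
    constructor
    · intro h
      have := key
      rw [h, mul_zero] at this
      exact (mul_eq_zero.1 this.symm).resolve_left htT
    · intro h
      have := key
      rw [h, mul_zero] at this
      exact (mul_eq_zero.1 this).resolve_left htκ

end PuiseuxInfinity

end Literature.FieldTheory.AlgClosed

end
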